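import Summits.QuantumFields.BalabanUV.Beta.D1BFx.GramWeightJets
import Summits.QuantumFields.BalabanUV.Beta.D1BFx.MixedVarPackedHess

/-!
# `BalabanUV.Beta.D1BFx.GramWeightJetsMixed` — road «BF-x» for binder row D1, slot (K), X₃(ii) ROUTE T, brick **K-TA4G «GRAM FORM OF THE
# JET IDENTITY»** (`HOME/b2b-balaban-beta-d1-p2/K-ASSEMBLY-SPEC-v2.md` v2.1 §2, shape (R2) «canonical co-frame», owner ruling ρ-g6-5), PART 2c —
# THE POLARISED (2-parameter, `mixedVar`) FORM AND THE `hessT` READ-OUT: the conclusion printed in K-ASSEMBLY-SPEC v2.0 §2,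
# `hessT (M⁻¹|_{ν⊕μ}; M-jets) + hessT (Φ₀⁻¹; Φ-jets) = hessT (N⁻¹; N-jets) + 2·hessT ((τW₀)⁻¹; τW-jets)`, under the (R2) hypotheses, together
# with the displayed split `hessT (Φ₀⁻¹; Φ-jets) = 2·hessT ((τ′₀W₀)⁻¹; (τ′W)-jets) + hessT (A₀⁻¹; A-jets)`

HONEST DEPENDENCY (cell records, verbatim): «continuum YM on T⁴ ⇐ BetaPertH ∧ nine spine estimates (0/9 proved); BetaPertH ⇐ (D1) ∧ (D4) ∧
CAP+tail; G-an2-4 gates asym, D1 and NE2/3/4.»  HONEST FRAMING (cell contract, verbatim): «discharging `BetaPertH` makes Bałaban's UV stability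
UNCONDITIONAL — a real constructive-QFT result; it is NOT the continuum limit and NOT the Clay problem.»  THIS MODULE DISCHARGES NOTHING of (K),
of D1 or of the wall: [folklore] finite-dimensional algebra over PART 2b `GramWeightJets` (`secondVar_gramTransfer_jets`, `secondVar_gram_split_jets`,
`gram₀∕₁∕₂`), the road owner's `SliceTransferJetsMixed` (`mixedVar`, `secondVar_diag`, `kkt_add`∕`kkt_smul`∕`kkt_fromRows_add`∕`_smul`) and this
lineage's TA4 `MixedVarPackedHess` (`hessT`, `mixedVar_kkt_fromRows_zero`, `mixedVar_eq_two_mul_hessT`) — all BY NAME.  One [our object] data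
definition (`gramMix`, the nine-term mixed Gram jet); no `def … : Prop`, nothing cited, no wall binder instantiated, 0 sorry.  NOT D1, NOT
BetaPertH, NOT continuum, NOT Clay.

ABSOLUTE RULE (cell charter, verbatim): «No internally-minted statement may enter as a cited fact. Every hypothesis is either kernel-proved in this
package or a verbatim quotation of a PUBLISHED theorem with page reference. The manuscript(s) under audit are NOT citable for their own disputed
steps — they are the thing under adjudication; programme-internal (2001/route/tribunal) claims are never citable.»

CONTENT:
* §1 [our object] `gramMix W₀ Wₛ Wₜ Wₛₜ B₀ Bₛ Bₜ Bₛₜ` (the mixed second jet of `WᵀBW`); [folklore] `gram₁_add`, **`gram₂_polarise`**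
  (`gram₂` along `s + t` = `gram₂(s) + 2·gramMix(s,t) + gram₂(t)`).
* §2 [folklore] **`mixedVar_gramTransfer_jets`** (the 18 two-sided Ward relations of `mixedVar_sliceTransfer_jets` for `K`, `Kᵀ`, `Q`; NO relation on
  the weight `B = gram τ′ A`; `det(τW₀)`, `det(τ′₀W₀)`, `det A₀`, `det M ≠ 0`) — PART 2b along `s`, `t`, `s + t` and polarisation; and
  **`hessT_gramTransfer_jets`** — the v2.0-printed conclusion.
* §3 [folklore] **`mixedVar_gram_split_jets`**, **`hessT_gram_split_jets`** (the split of ρ-g6-5).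
NOT HERE: the colour lift K-TA4C (v2.2), the torus instantiation (TB3∕TB4∕TB5).
Provenance: G-an2-4 formalisation swarm leaf seat `b2b-balaban-gan24-formalise-leaf-03` gen 44 (cross-lane), claim «K-TA4G» PART 2c, 2026-08-20.
-/

noncomputable section

namespace Summit.QuantumFields.BalabanUV.Beta.D1BFx.GramWeightJetsMixed

open Matrix
open Literature.MathematicalPhysics.QuantumFieldTheory.Balaban1983to89.Beta.Composition (kkt)
open Summit.QuantumFields.BalabanUV.Beta.D1BFx.LogDetSecondVariation (secondVar)
open Summit.QuantumFields.BalabanUV.Beta.D1BFx.SliceTransferJetsMixed (mixedVar secondVar_diag kkt_fromRows_add kkt_fromRows_smul kkt_add kkt_smul)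
open Summit.QuantumFields.BalabanUV.Beta.D1BFx.MixedVarPackedHess (hessT mixedVar_kkt_fromRows_zero mixedVar_eq_two_mul_hessT)
open Summit.QuantumFields.BalabanUV.Beta.D1BFx.GramWeightJets (gram₀ gram₁ gram₂ secondVar_gramTransfer_jets secondVar_gram_split_jets)

/-! ## §1 The mixed Gram jet and the polarisation of the Gram jet polynomials -/

section Gram

variable {ι κ : Type*} [Fintype ι] [Fintype κ]

/-- [our object] THE MIXED SECOND GRAM JET of `WᵀBW` along two directions (nine-term product rule): for first jets `(Wₛ, Bₛ)`, `(Wₜ, Bₜ)` and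
mixed second jets `(Wₛₜ, Bₛₜ)`. -/
def gramMix (W₀ Wₛ Wₜ Wₛₜ : Matrix ι κ ℝ) (B₀ Bₛ Bₜ Bₛₜ : Matrix ι ι ℝ) : Matrix κ κ ℝ :=
  Wₛₜᵀ * B₀ * W₀ + Wₛᵀ * Bₜ * W₀ + Wₜᵀ * Bₛ * W₀ + W₀ᵀ * Bₛₜ * W₀ + Wₛᵀ * B₀ * Wₜ + Wₜᵀ * B₀ * Wₛ
    + W₀ᵀ * Bₛ * Wₜ + W₀ᵀ * Bₜ * Wₛ + W₀ᵀ * B₀ * Wₛₜ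

variable (W₀ Wₛ Wₜ Wₛₛ Wₜₜ Wₛₜ : Matrix ι κ ℝ) (B₀ Bₛ Bₜ Bₛₛ Bₜₜ Bₛₜ : Matrix ι ι ℝ)

omit [Fintype κ] in
/-- [folklore] The first Gram jet is additive in the pair (basis jet, weight jet). -/
theorem gram₁_add : gram₁ W₀ (Wₛ + Wₜ) B₀ (Bₛ + Bₜ) = gram₁ W₀ Wₛ B₀ Bₛ + gram₁ W₀ Wₜ B₀ Bₜ := by
  simp only [gram₁, Matrix.transpose_add, Matrix.add_mul, Matrix.mul_add]
  abel

omit [Fintype κ] in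
/-- [folklore] **POLARISATION OF THE SECOND GRAM JET**: along `s + t` (first jets added, second jets `Xₛₛ + 2·Xₛₜ + Xₜₜ`) the second Gram jet is
`gram₂(s) + 2·gramMix(s,t) + gram₂(t)`. -/
theorem gram₂_polarise :
    gram₂ W₀ (Wₛ + Wₜ) (Wₛₛ + (2 : ℝ) • Wₛₜ + Wₜₜ) B₀ (Bₛ + Bₜ) (Bₛₛ + (2 : ℝ) • Bₛₜ + Bₜₜ)
      = gram₂ W₀ Wₛ Wₛₛ B₀ Bₛ Bₛₛ + (2 : ℝ) • gramMix W₀ Wₛ Wₜ Wₛₜ B₀ Bₛ Bₜ Bₛₜ + gram₂ W₀ Wₜ Wₜₜ B₀ Bₜ Bₜₜ := by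
  simp only [gram₂, gramMix, Matrix.transpose_add, Matrix.add_mul, Matrix.mul_add, Matrix.mul_assoc, two_smul, smul_add]
  abel

end Gram

/-! ## §2 The polarised (2-parameter) Gram-form identity -/

section Main

variable {ν μ ρ : Type*} [Fintype ν] [Fintype μ] [Fintype ρ] [DecidableEq ν] [DecidableEq μ] [DecidableEq ρ]

/-- [folklore] **K-TA4G, MIXED FUNCTIONALS (shape (R2)).**  2-parameter jet data: first jets along `s` and `t`, pure second jets `…ₛₛ`, `…ₜₜ` and
MIXED second jets `…ₛₜ` of `K` (form), `Q` (constraint), `τ′` (co-frame), `A`, `W` (gauge basis); constant comb rows `τ`.  Under the algebraic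
Ward relations along `s`, along `t` and the mixed ones (for `K`, `Kᵀ`, `Q` — the 18 relations of `SliceTransferJetsMixed.mixedVar_sliceTransfer_jets`)
and `det(τW₀)`, `det(τ′₀W₀)`, `det A₀`, `det kkt K₀ [Q₀; τ] ≠ 0`:  `mixedVar M + mixedVar Φ = mixedVar N + 2·mixedVar (τW)`, the weight jets being
`B₀ = gram₀ τ′₀ A₀`, `Bₛ = gram₁ τ′₀ τ′ₛ A₀ Aₛ`, `Bₜ`, `Bₛₜ = gramMix τ′ A`, the FP Gram jets `gram₀ W₀ B₀`, `gram₁ W₀ Wₛ B₀ Bₛ`, `gram₁ W₀ Wₜ B₀ Bₜ`,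
`gramMix W B`, and `N`'s jets `kkt (K· + B·) Q·`. -/
theorem mixedVar_gramTransfer_jets (K₀ Kₛ Kₜ Kₛₛ Kₜₜ Kₛₜ : Matrix ν ν ℝ) (Q₀ Qₛ Qₜ Qₛₛ Qₜₜ Qₛₜ : Matrix μ ν ℝ)
    (T₀ Tₛ Tₜ Tₛₛ Tₜₜ Tₛₜ : Matrix ρ ν ℝ) (A₀ Aₛ Aₜ Aₛₛ Aₜₜ Aₛₜ : Matrix ρ ρ ℝ) (W₀ Wₛ Wₜ Wₛₛ Wₜₜ Wₛₜ : Matrix ν ρ ℝ) (τ : Matrix ρ ν ℝ)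
    (a0 : K₀ * W₀ = 0) (a0t : K₀ᵀ * W₀ = 0)
    (aₛ : Kₛ * W₀ + K₀ * Wₛ = 0) (aₛt : Kₛᵀ * W₀ + K₀ᵀ * Wₛ = 0) (aₜ : Kₜ * W₀ + K₀ * Wₜ = 0) (aₜt : Kₜᵀ * W₀ + K₀ᵀ * Wₜ = 0)
    (aₛₛ : Kₛₛ * W₀ + (2 : ℝ) • (Kₛ * Wₛ) + K₀ * Wₛₛ = 0) (aₛₛt : Kₛₛᵀ * W₀ + (2 : ℝ) • (Kₛᵀ * Wₛ) + K₀ᵀ * Wₛₛ = 0)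
    (aₜₜ : Kₜₜ * W₀ + (2 : ℝ) • (Kₜ * Wₜ) + K₀ * Wₜₜ = 0) (aₜₜt : Kₜₜᵀ * W₀ + (2 : ℝ) • (Kₜᵀ * Wₜ) + K₀ᵀ * Wₜₜ = 0)
    (aₛₜ : Kₛₜ * W₀ + Kₛ * Wₜ + Kₜ * Wₛ + K₀ * Wₛₜ = 0) (aₛₜt : Kₛₜᵀ * W₀ + Kₛᵀ * Wₜ + Kₜᵀ * Wₛ + K₀ᵀ * Wₛₜ = 0)
    (b0 : Q₀ * W₀ = 0) (bₛ : Qₛ * W₀ + Q₀ * Wₛ = 0) (bₜ : Qₜ * W₀ + Q₀ * Wₜ = 0)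
    (bₛₛ : Qₛₛ * W₀ + (2 : ℝ) • (Qₛ * Wₛ) + Q₀ * Wₛₛ = 0) (bₜₜ : Qₜₜ * W₀ + (2 : ℝ) • (Qₜ * Wₜ) + Q₀ * Wₜₜ = 0)
    (bₛₜ : Qₛₜ * W₀ + Qₛ * Wₜ + Qₜ * Wₛ + Q₀ * Wₛₜ = 0)
    (hτ : (τ * W₀).det ≠ 0) (hT : (T₀ * W₀).det ≠ 0) (hA : A₀.det ≠ 0) (hM : (kkt K₀ (fromRows Q₀ τ)).det ≠ 0) :
    mixedVar (kkt K₀ (fromRows Q₀ τ)) (kkt Kₛ (fromRows Qₛ (0 : Matrix ρ ν ℝ))) (kkt Kₜ (fromRows Qₜ (0 : Matrix ρ ν ℝ)))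
        (kkt Kₛₜ (fromRows Qₛₜ (0 : Matrix ρ ν ℝ)))
      + mixedVar (gram₀ W₀ (gram₀ T₀ A₀)) (gram₁ W₀ Wₛ (gram₀ T₀ A₀) (gram₁ T₀ Tₛ A₀ Aₛ)) (gram₁ W₀ Wₜ (gram₀ T₀ A₀) (gram₁ T₀ Tₜ A₀ Aₜ))
        (gramMix W₀ Wₛ Wₜ Wₛₜ (gram₀ T₀ A₀) (gram₁ T₀ Tₛ A₀ Aₛ) (gram₁ T₀ Tₜ A₀ Aₜ) (gramMix T₀ Tₛ Tₜ Tₛₜ A₀ Aₛ Aₜ Aₛₜ))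
    = mixedVar (kkt (K₀ + gram₀ T₀ A₀) Q₀) (kkt (Kₛ + gram₁ T₀ Tₛ A₀ Aₛ) Qₛ) (kkt (Kₜ + gram₁ T₀ Tₜ A₀ Aₜ) Qₜ)
        (kkt (Kₛₜ + gramMix T₀ Tₛ Tₜ Tₛₜ A₀ Aₛ Aₜ Aₛₜ) Qₛₜ)
      + 2 * mixedVar (τ * W₀) (τ * Wₛ) (τ * Wₜ) (τ * Wₛₜ) := by
  -- the three one-parameter identities: along s, along t, along the diagonal
  have hs := secondVar_gramTransfer_jets K₀ Kₛ Kₛₛ Q₀ Qₛ Qₛₛ T₀ Tₛ Tₛₛ A₀ Aₛ Aₛₛ W₀ Wₛ Wₛₛ τ a0 a0t aₛ aₛt aₛₛ aₛₛt b0 bₛ bₛₛ hτ hT hA hM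
  have ht := secondVar_gramTransfer_jets K₀ Kₜ Kₜₜ Q₀ Qₜ Qₜₜ T₀ Tₜ Tₜₜ A₀ Aₜ Aₜₜ W₀ Wₜ Wₜₜ τ a0 a0t aₜ aₜt aₜₜ aₜₜt b0 bₜ bₜₜ hτ hT hA hM
  have dK1 : (Kₛ + Kₜ) * W₀ + K₀ * (Wₛ + Wₜ) = 0 := by
    rw [Matrix.add_mul, Matrix.mul_add]; rw [← aₛ, ← add_zero (Kₛ * W₀ + K₀ * Wₛ), ← aₜ]; abel
  have dK1t : (Kₛ + Kₜ)ᵀ * W₀ + K₀ᵀ * (Wₛ + Wₜ) = 0 := by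
    rw [Matrix.transpose_add, Matrix.add_mul, Matrix.mul_add]; rw [← aₛt, ← add_zero (Kₛᵀ * W₀ + K₀ᵀ * Wₛ), ← aₜt]; abel
  have dK2 : (Kₛₛ + (2 : ℝ) • Kₛₜ + Kₜₜ) * W₀ + (2 : ℝ) • ((Kₛ + Kₜ) * (Wₛ + Wₜ)) + K₀ * (Wₛₛ + (2 : ℝ) • Wₛₜ + Wₜₜ) = 0 := by
    have e : (Kₛₛ + (2 : ℝ) • Kₛₜ + Kₜₜ) * W₀ + (2 : ℝ) • ((Kₛ + Kₜ) * (Wₛ + Wₜ)) + K₀ * (Wₛₛ + (2 : ℝ) • Wₛₜ + Wₜₜ)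
        = (Kₛₛ * W₀ + (2 : ℝ) • (Kₛ * Wₛ) + K₀ * Wₛₛ) + (Kₜₜ * W₀ + (2 : ℝ) • (Kₜ * Wₜ) + K₀ * Wₜₜ)
          + (2 : ℝ) • (Kₛₜ * W₀ + Kₛ * Wₜ + Kₜ * Wₛ + K₀ * Wₛₜ) := by
      simp only [Matrix.add_mul, Matrix.mul_add, Matrix.smul_mul, Matrix.mul_smul, smul_add]
      abel
    rw [e, aₛₛ, aₜₜ, aₛₜ, smul_zero, add_zero, add_zero]
  have dK2t : (Kₛₛ + (2 : ℝ) • Kₛₜ + Kₜₜ)ᵀ * W₀ + (2 : ℝ) • ((Kₛ + Kₜ)ᵀ * (Wₛ + Wₜ)) + K₀ᵀ * (Wₛₛ + (2 : ℝ) • Wₛₜ + Wₜₜ) = 0 := by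
    have e : (Kₛₛ + (2 : ℝ) • Kₛₜ + Kₜₜ)ᵀ * W₀ + (2 : ℝ) • ((Kₛ + Kₜ)ᵀ * (Wₛ + Wₜ)) + K₀ᵀ * (Wₛₛ + (2 : ℝ) • Wₛₜ + Wₜₜ)
        = (Kₛₛᵀ * W₀ + (2 : ℝ) • (Kₛᵀ * Wₛ) + K₀ᵀ * Wₛₛ) + (Kₜₜᵀ * W₀ + (2 : ℝ) • (Kₜᵀ * Wₜ) + K₀ᵀ * Wₜₜ)
          + (2 : ℝ) • (Kₛₜᵀ * W₀ + Kₛᵀ * Wₜ + Kₜᵀ * Wₛ + K₀ᵀ * Wₛₜ) := by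
      simp only [Matrix.transpose_add, Matrix.transpose_smul, Matrix.add_mul, Matrix.mul_add, Matrix.smul_mul, Matrix.mul_smul, smul_add]
      abel
    rw [e, aₛₛt, aₜₜt, aₛₜt, smul_zero, add_zero, add_zero]
  have dQ1 : (Qₛ + Qₜ) * W₀ + Q₀ * (Wₛ + Wₜ) = 0 := by
    rw [Matrix.add_mul, Matrix.mul_add]; rw [← bₛ, ← add_zero (Qₛ * W₀ + Q₀ * Wₛ), ← bₜ]; abel
  have dQ2 : (Qₛₛ + (2 : ℝ) • Qₛₜ + Qₜₜ) * W₀ + (2 : ℝ) • ((Qₛ + Qₜ) * (Wₛ + Wₜ)) + Q₀ * (Wₛₛ + (2 : ℝ) • Wₛₜ + Wₜₜ) = 0 := by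
    have e : (Qₛₛ + (2 : ℝ) • Qₛₜ + Qₜₜ) * W₀ + (2 : ℝ) • ((Qₛ + Qₜ) * (Wₛ + Wₜ)) + Q₀ * (Wₛₛ + (2 : ℝ) • Wₛₜ + Wₜₜ)
        = (Qₛₛ * W₀ + (2 : ℝ) • (Qₛ * Wₛ) + Q₀ * Wₛₛ) + (Qₜₜ * W₀ + (2 : ℝ) • (Qₜ * Wₜ) + Q₀ * Wₜₜ)
          + (2 : ℝ) • (Qₛₜ * W₀ + Qₛ * Wₜ + Qₜ * Wₛ + Q₀ * Wₛₜ) := by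
      simp only [Matrix.add_mul, Matrix.mul_add, Matrix.smul_mul, Matrix.mul_smul, smul_add]
      abel
    rw [e, bₛₛ, bₜₜ, bₛₜ, smul_zero, add_zero, add_zero]
  have hd := secondVar_gramTransfer_jets K₀ (Kₛ + Kₜ) (Kₛₛ + (2 : ℝ) • Kₛₜ + Kₜₜ) Q₀ (Qₛ + Qₜ) (Qₛₛ + (2 : ℝ) • Qₛₜ + Qₜₜ)
    T₀ (Tₛ + Tₜ) (Tₛₛ + (2 : ℝ) • Tₛₜ + Tₜₜ) A₀ (Aₛ + Aₜ) (Aₛₛ + (2 : ℝ) • Aₛₜ + Aₜₜ) W₀ (Wₛ + Wₜ) (Wₛₛ + (2 : ℝ) • Wₛₜ + Wₜₜ) τ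
    a0 a0t dK1 dK1t dK2 dK2t b0 dQ1 dQ2 hτ hT hA hM
  -- polarise the weight jets and the Gram jets
  rw [gram₁_add T₀ Tₛ Tₜ A₀ Aₛ Aₜ, gram₂_polarise T₀ Tₛ Tₜ Tₛₛ Tₜₜ Tₛₜ A₀ Aₛ Aₜ Aₛₛ Aₜₜ Aₛₜ, gram₁_add, gram₂_polarise] at hd
  -- polarisation of each of the four functionals
  have pM : secondVar (kkt K₀ (fromRows Q₀ τ)) (kkt (Kₛ + Kₜ) (fromRows (Qₛ + Qₜ) (0 : Matrix ρ ν ℝ)))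
        (kkt (Kₛₛ + (2 : ℝ) • Kₛₜ + Kₜₜ) (fromRows (Qₛₛ + (2 : ℝ) • Qₛₜ + Qₜₜ) (0 : Matrix ρ ν ℝ)))
      = secondVar (kkt K₀ (fromRows Q₀ τ)) (kkt Kₛ (fromRows Qₛ 0)) (kkt Kₛₛ (fromRows Qₛₛ 0))
        + secondVar (kkt K₀ (fromRows Q₀ τ)) (kkt Kₜ (fromRows Qₜ 0)) (kkt Kₜₜ (fromRows Qₜₜ 0))
        + 2 * mixedVar (kkt K₀ (fromRows Q₀ τ)) (kkt Kₛ (fromRows Qₛ 0)) (kkt Kₜ (fromRows Qₜ 0)) (kkt Kₛₜ (fromRows Qₛₜ 0)) := by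
    rw [kkt_fromRows_add, kkt_fromRows_add, kkt_fromRows_add, kkt_fromRows_smul]
    exact secondVar_diag _ _ _ _ _ _
  have pΦ : secondVar (gram₀ W₀ (gram₀ T₀ A₀))
        (gram₁ W₀ Wₛ (gram₀ T₀ A₀) (gram₁ T₀ Tₛ A₀ Aₛ) + gram₁ W₀ Wₜ (gram₀ T₀ A₀) (gram₁ T₀ Tₜ A₀ Aₜ))
        (gram₂ W₀ Wₛ Wₛₛ (gram₀ T₀ A₀) (gram₁ T₀ Tₛ A₀ Aₛ) (gram₂ T₀ Tₛ Tₛₛ A₀ Aₛ Aₛₛ)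
          + (2 : ℝ) • gramMix W₀ Wₛ Wₜ Wₛₜ (gram₀ T₀ A₀) (gram₁ T₀ Tₛ A₀ Aₛ) (gram₁ T₀ Tₜ A₀ Aₜ) (gramMix T₀ Tₛ Tₜ Tₛₜ A₀ Aₛ Aₜ Aₛₜ)
          + gram₂ W₀ Wₜ Wₜₜ (gram₀ T₀ A₀) (gram₁ T₀ Tₜ A₀ Aₜ) (gram₂ T₀ Tₜ Tₜₜ A₀ Aₜ Aₜₜ))
      = secondVar (gram₀ W₀ (gram₀ T₀ A₀)) (gram₁ W₀ Wₛ (gram₀ T₀ A₀) (gram₁ T₀ Tₛ A₀ Aₛ)) (gram₂ W₀ Wₛ Wₛₛ (gram₀ T₀ A₀) (gram₁ T₀ Tₛ A₀ Aₛ) (gram₂ T₀ Tₛ Tₛₛ A₀ Aₛ Aₛₛ))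
        + secondVar (gram₀ W₀ (gram₀ T₀ A₀)) (gram₁ W₀ Wₜ (gram₀ T₀ A₀) (gram₁ T₀ Tₜ A₀ Aₜ)) (gram₂ W₀ Wₜ Wₜₜ (gram₀ T₀ A₀) (gram₁ T₀ Tₜ A₀ Aₜ) (gram₂ T₀ Tₜ Tₜₜ A₀ Aₜ Aₜₜ))
        + 2 * mixedVar (gram₀ W₀ (gram₀ T₀ A₀)) (gram₁ W₀ Wₛ (gram₀ T₀ A₀) (gram₁ T₀ Tₛ A₀ Aₛ)) (gram₁ W₀ Wₜ (gram₀ T₀ A₀) (gram₁ T₀ Tₜ A₀ Aₜ))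
            (gramMix W₀ Wₛ Wₜ Wₛₜ (gram₀ T₀ A₀) (gram₁ T₀ Tₛ A₀ Aₛ) (gram₁ T₀ Tₜ A₀ Aₜ) (gramMix T₀ Tₛ Tₜ Tₛₜ A₀ Aₛ Aₜ Aₛₜ)) :=
    secondVar_diag _ _ _ _ _ _
  have pN : secondVar (kkt (K₀ + gram₀ T₀ A₀) Q₀) (kkt (Kₛ + Kₜ + (gram₁ T₀ Tₛ A₀ Aₛ + gram₁ T₀ Tₜ A₀ Aₜ)) (Qₛ + Qₜ))
        (kkt (Kₛₛ + (2 : ℝ) • Kₛₜ + Kₜₜ + (gram₂ T₀ Tₛ Tₛₛ A₀ Aₛ Aₛₛ + (2 : ℝ) • gramMix T₀ Tₛ Tₜ Tₛₜ A₀ Aₛ Aₜ Aₛₜ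
          + gram₂ T₀ Tₜ Tₜₜ A₀ Aₜ Aₜₜ)) (Qₛₛ + (2 : ℝ) • Qₛₜ + Qₜₜ))
      = secondVar (kkt (K₀ + gram₀ T₀ A₀) Q₀) (kkt (Kₛ + gram₁ T₀ Tₛ A₀ Aₛ) Qₛ) (kkt (Kₛₛ + gram₂ T₀ Tₛ Tₛₛ A₀ Aₛ Aₛₛ) Qₛₛ)
        + secondVar (kkt (K₀ + gram₀ T₀ A₀) Q₀) (kkt (Kₜ + gram₁ T₀ Tₜ A₀ Aₜ) Qₜ) (kkt (Kₜₜ + gram₂ T₀ Tₜ Tₜₜ A₀ Aₜ Aₜₜ) Qₜₜ)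
        + 2 * mixedVar (kkt (K₀ + gram₀ T₀ A₀) Q₀) (kkt (Kₛ + gram₁ T₀ Tₛ A₀ Aₛ) Qₛ) (kkt (Kₜ + gram₁ T₀ Tₜ A₀ Aₜ) Qₜ)
            (kkt (Kₛₜ + gramMix T₀ Tₛ Tₜ Tₛₜ A₀ Aₛ Aₜ Aₛₜ) Qₛₜ) := by
    have e1 : kkt (Kₛ + Kₜ + (gram₁ T₀ Tₛ A₀ Aₛ + gram₁ T₀ Tₜ A₀ Aₜ)) (Qₛ + Qₜ)
        = kkt (Kₛ + gram₁ T₀ Tₛ A₀ Aₛ) Qₛ + kkt (Kₜ + gram₁ T₀ Tₜ A₀ Aₜ) Qₜ := by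
      rw [← kkt_add]; congr 1; abel
    have e2 : kkt (Kₛₛ + (2 : ℝ) • Kₛₜ + Kₜₜ + (gram₂ T₀ Tₛ Tₛₛ A₀ Aₛ Aₛₛ + (2 : ℝ) • gramMix T₀ Tₛ Tₜ Tₛₜ A₀ Aₛ Aₜ Aₛₜ
          + gram₂ T₀ Tₜ Tₜₜ A₀ Aₜ Aₜₜ)) (Qₛₛ + (2 : ℝ) • Qₛₜ + Qₜₜ)
        = kkt (Kₛₛ + gram₂ T₀ Tₛ Tₛₛ A₀ Aₛ Aₛₛ) Qₛₛ + (2 : ℝ) • kkt (Kₛₜ + gramMix T₀ Tₛ Tₜ Tₛₜ A₀ Aₛ Aₜ Aₛₜ) Qₛₜ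
          + kkt (Kₜₜ + gram₂ T₀ Tₜ Tₜₜ A₀ Aₜ Aₜₜ) Qₜₜ := by
      rw [← kkt_smul, ← kkt_add, ← kkt_add]; congr 1
      simp only [smul_add]; abel
    rw [e1, e2]
    exact secondVar_diag _ _ _ _ _ _
  have pG : secondVar (τ * W₀) (τ * (Wₛ + Wₜ)) (τ * (Wₛₛ + (2 : ℝ) • Wₛₜ + Wₜₜ))
      = secondVar (τ * W₀) (τ * Wₛ) (τ * Wₛₛ) + secondVar (τ * W₀) (τ * Wₜ) (τ * Wₜₜ)
        + 2 * mixedVar (τ * W₀) (τ * Wₛ) (τ * Wₜ) (τ * Wₛₜ) := by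
    rw [Matrix.mul_add, Matrix.mul_add, Matrix.mul_add, Matrix.mul_smul]
    exact secondVar_diag _ _ _ _ _ _
  rw [pM, pΦ, pN, pG] at hd
  linarith


/-- [folklore] **K-TA4G IN `hessT` CURRENCY — THE CONCLUSION PRINTED IN K-ASSEMBLY-SPEC v2.0 §2 (now with the (R2) hypotheses of v2.1):**
`hessT (M⁻¹|_{ν⊕μ}; M-jets) + hessT (Φ₀⁻¹; Φ-jets) = hessT (N⁻¹; N-jets) + 2·hessT ((τW₀)⁻¹; τW-jets)`, the packed `(ν ⊕ μ)`-corner of `M⁻¹` read by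
TA4's `mixedVar_kkt_fromRows_zero`, the other three by `mixedVar = 2·hessT (·)⁻¹`. -/
theorem hessT_gramTransfer_jets (K₀ Kₛ Kₜ Kₛₛ Kₜₜ Kₛₜ : Matrix ν ν ℝ) (Q₀ Qₛ Qₜ Qₛₛ Qₜₜ Qₛₜ : Matrix μ ν ℝ)
    (T₀ Tₛ Tₜ Tₛₛ Tₜₜ Tₛₜ : Matrix ρ ν ℝ) (A₀ Aₛ Aₜ Aₛₛ Aₜₜ Aₛₜ : Matrix ρ ρ ℝ) (W₀ Wₛ Wₜ Wₛₛ Wₜₜ Wₛₜ : Matrix ν ρ ℝ) (τ : Matrix ρ ν ℝ)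
    (a0 : K₀ * W₀ = 0) (a0t : K₀ᵀ * W₀ = 0)
    (aₛ : Kₛ * W₀ + K₀ * Wₛ = 0) (aₛt : Kₛᵀ * W₀ + K₀ᵀ * Wₛ = 0) (aₜ : Kₜ * W₀ + K₀ * Wₜ = 0) (aₜt : Kₜᵀ * W₀ + K₀ᵀ * Wₜ = 0)
    (aₛₛ : Kₛₛ * W₀ + (2 : ℝ) • (Kₛ * Wₛ) + K₀ * Wₛₛ = 0) (aₛₛt : Kₛₛᵀ * W₀ + (2 : ℝ) • (Kₛᵀ * Wₛ) + K₀ᵀ * Wₛₛ = 0)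
    (aₜₜ : Kₜₜ * W₀ + (2 : ℝ) • (Kₜ * Wₜ) + K₀ * Wₜₜ = 0) (aₜₜt : Kₜₜᵀ * W₀ + (2 : ℝ) • (Kₜᵀ * Wₜ) + K₀ᵀ * Wₜₜ = 0)
    (aₛₜ : Kₛₜ * W₀ + Kₛ * Wₜ + Kₜ * Wₛ + K₀ * Wₛₜ = 0) (aₛₜt : Kₛₜᵀ * W₀ + Kₛᵀ * Wₜ + Kₜᵀ * Wₛ + K₀ᵀ * Wₛₜ = 0)
    (b0 : Q₀ * W₀ = 0) (bₛ : Qₛ * W₀ + Q₀ * Wₛ = 0) (bₜ : Qₜ * W₀ + Q₀ * Wₜ = 0)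
    (bₛₛ : Qₛₛ * W₀ + (2 : ℝ) • (Qₛ * Wₛ) + Q₀ * Wₛₛ = 0) (bₜₜ : Qₜₜ * W₀ + (2 : ℝ) • (Qₜ * Wₜ) + Q₀ * Wₜₜ = 0)
    (bₛₜ : Qₛₜ * W₀ + Qₛ * Wₜ + Qₜ * Wₛ + Q₀ * Wₛₜ = 0)
    (hτ : (τ * W₀).det ≠ 0) (hT : (T₀ * W₀).det ≠ 0) (hA : A₀.det ≠ 0) (hM : (kkt K₀ (fromRows Q₀ τ)).det ≠ 0) :
    hessT ((kkt K₀ (fromRows Q₀ τ))⁻¹.submatrix (Sum.map id Sum.inl) (Sum.map id Sum.inl)) (kkt Kₛ Qₛ) (kkt Kₜ Qₜ) (kkt Kₛₜ Qₛₜ)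
      + hessT (gram₀ W₀ (gram₀ T₀ A₀))⁻¹ (gram₁ W₀ Wₛ (gram₀ T₀ A₀) (gram₁ T₀ Tₛ A₀ Aₛ)) (gram₁ W₀ Wₜ (gram₀ T₀ A₀) (gram₁ T₀ Tₜ A₀ Aₜ))
          (gramMix W₀ Wₛ Wₜ Wₛₜ (gram₀ T₀ A₀) (gram₁ T₀ Tₛ A₀ Aₛ) (gram₁ T₀ Tₜ A₀ Aₜ) (gramMix T₀ Tₛ Tₜ Tₛₜ A₀ Aₛ Aₜ Aₛₜ))
    = hessT (kkt (K₀ + gram₀ T₀ A₀) Q₀)⁻¹ (kkt (Kₛ + gram₁ T₀ Tₛ A₀ Aₛ) Qₛ) (kkt (Kₜ + gram₁ T₀ Tₜ A₀ Aₜ) Qₜ)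
          (kkt (Kₛₜ + gramMix T₀ Tₛ Tₜ Tₛₜ A₀ Aₛ Aₜ Aₛₜ) Qₛₜ)
      + 2 * hessT (τ * W₀)⁻¹ (τ * Wₛ) (τ * Wₜ) (τ * Wₛₜ) := by
  have h := mixedVar_gramTransfer_jets K₀ Kₛ Kₜ Kₛₛ Kₜₜ Kₛₜ Q₀ Qₛ Qₜ Qₛₛ Qₜₜ Qₛₜ T₀ Tₛ Tₜ Tₛₛ Tₜₜ Tₛₜ A₀ Aₛ Aₜ Aₛₛ Aₜₜ Aₛₜ
    W₀ Wₛ Wₜ Wₛₛ Wₜₜ Wₛₜ τ a0 a0t aₛ aₛt aₜ aₜt aₛₛ aₛₛt aₜₜ aₜₜt aₛₜ aₛₜt b0 bₛ bₜ bₛₛ bₜₜ bₛₜ hτ hT hA hM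
  rw [mixedVar_kkt_fromRows_zero, mixedVar_eq_two_mul_hessT (gram₀ W₀ (gram₀ T₀ A₀)),
    mixedVar_eq_two_mul_hessT (kkt (K₀ + gram₀ T₀ A₀) Q₀), mixedVar_eq_two_mul_hessT (τ * W₀)] at h
  linarith

/-! ## §3 The polarised Gram split and its `hessT` form -/

omit [DecidableEq ν] in
/-- [folklore] **THE GRAM SPLIT, MIXED FUNCTIONALS**: `mixedVar Φ = 2·mixedVar (τ′W) + mixedVar A` for the 2-parameter jets of §2 (weight
`B = gram τ′ A`, FP Gram `Φ = gram W B`; `det(τ′₀W₀)`, `det A₀ ≠ 0`). -/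
theorem mixedVar_gram_split_jets (T₀ Tₛ Tₜ Tₛₛ Tₜₜ Tₛₜ : Matrix ρ ν ℝ) (A₀ Aₛ Aₜ Aₛₛ Aₜₜ Aₛₜ : Matrix ρ ρ ℝ)
    (W₀ Wₛ Wₜ Wₛₛ Wₜₜ Wₛₜ : Matrix ν ρ ℝ) (hT : (T₀ * W₀).det ≠ 0) (hA : A₀.det ≠ 0) :
    mixedVar (gram₀ W₀ (gram₀ T₀ A₀)) (gram₁ W₀ Wₛ (gram₀ T₀ A₀) (gram₁ T₀ Tₛ A₀ Aₛ)) (gram₁ W₀ Wₜ (gram₀ T₀ A₀) (gram₁ T₀ Tₜ A₀ Aₜ))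
        (gramMix W₀ Wₛ Wₜ Wₛₜ (gram₀ T₀ A₀) (gram₁ T₀ Tₛ A₀ Aₛ) (gram₁ T₀ Tₜ A₀ Aₜ) (gramMix T₀ Tₛ Tₜ Tₛₜ A₀ Aₛ Aₜ Aₛₜ))
      = 2 * mixedVar (T₀ * W₀) (Tₛ * W₀ + T₀ * Wₛ) (Tₜ * W₀ + T₀ * Wₜ) (Tₛₜ * W₀ + Tₛ * Wₜ + Tₜ * Wₛ + T₀ * Wₛₜ)
        + mixedVar A₀ Aₛ Aₜ Aₛₜ := by
  have hs := secondVar_gram_split_jets T₀ Tₛ Tₛₛ A₀ Aₛ Aₛₛ W₀ Wₛ Wₛₛ hT hA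
  have ht := secondVar_gram_split_jets T₀ Tₜ Tₜₜ A₀ Aₜ Aₜₜ W₀ Wₜ Wₜₜ hT hA
  have hd := secondVar_gram_split_jets T₀ (Tₛ + Tₜ) (Tₛₛ + (2 : ℝ) • Tₛₜ + Tₜₜ) A₀ (Aₛ + Aₜ) (Aₛₛ + (2 : ℝ) • Aₛₜ + Aₜₜ)
    W₀ (Wₛ + Wₜ) (Wₛₛ + (2 : ℝ) • Wₛₜ + Wₜₜ) hT hA
  rw [gram₁_add T₀ Tₛ Tₜ A₀ Aₛ Aₜ, gram₂_polarise T₀ Tₛ Tₜ Tₛₛ Tₜₜ Tₛₜ A₀ Aₛ Aₜ Aₛₛ Aₜₜ Aₛₜ, gram₁_add, gram₂_polarise] at hd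
  have pΦ : secondVar (gram₀ W₀ (gram₀ T₀ A₀))
        (gram₁ W₀ Wₛ (gram₀ T₀ A₀) (gram₁ T₀ Tₛ A₀ Aₛ) + gram₁ W₀ Wₜ (gram₀ T₀ A₀) (gram₁ T₀ Tₜ A₀ Aₜ))
        (gram₂ W₀ Wₛ Wₛₛ (gram₀ T₀ A₀) (gram₁ T₀ Tₛ A₀ Aₛ) (gram₂ T₀ Tₛ Tₛₛ A₀ Aₛ Aₛₛ)
          + (2 : ℝ) • gramMix W₀ Wₛ Wₜ Wₛₜ (gram₀ T₀ A₀) (gram₁ T₀ Tₛ A₀ Aₛ) (gram₁ T₀ Tₜ A₀ Aₜ) (gramMix T₀ Tₛ Tₜ Tₛₜ A₀ Aₛ Aₜ Aₛₜ)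
          + gram₂ W₀ Wₜ Wₜₜ (gram₀ T₀ A₀) (gram₁ T₀ Tₜ A₀ Aₜ) (gram₂ T₀ Tₜ Tₜₜ A₀ Aₜ Aₜₜ))
      = secondVar (gram₀ W₀ (gram₀ T₀ A₀)) (gram₁ W₀ Wₛ (gram₀ T₀ A₀) (gram₁ T₀ Tₛ A₀ Aₛ)) (gram₂ W₀ Wₛ Wₛₛ (gram₀ T₀ A₀) (gram₁ T₀ Tₛ A₀ Aₛ) (gram₂ T₀ Tₛ Tₛₛ A₀ Aₛ Aₛₛ))
        + secondVar (gram₀ W₀ (gram₀ T₀ A₀)) (gram₁ W₀ Wₜ (gram₀ T₀ A₀) (gram₁ T₀ Tₜ A₀ Aₜ)) (gram₂ W₀ Wₜ Wₜₜ (gram₀ T₀ A₀) (gram₁ T₀ Tₜ A₀ Aₜ) (gram₂ T₀ Tₜ Tₜₜ A₀ Aₜ Aₜₜ))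
        + 2 * mixedVar (gram₀ W₀ (gram₀ T₀ A₀)) (gram₁ W₀ Wₛ (gram₀ T₀ A₀) (gram₁ T₀ Tₛ A₀ Aₛ)) (gram₁ W₀ Wₜ (gram₀ T₀ A₀) (gram₁ T₀ Tₜ A₀ Aₜ))
            (gramMix W₀ Wₛ Wₜ Wₛₜ (gram₀ T₀ A₀) (gram₁ T₀ Tₛ A₀ Aₛ) (gram₁ T₀ Tₜ A₀ Aₜ) (gramMix T₀ Tₛ Tₜ Tₛₜ A₀ Aₛ Aₜ Aₛₜ)) :=
    secondVar_diag _ _ _ _ _ _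
  have pF : secondVar (T₀ * W₀) ((Tₛ + Tₜ) * W₀ + T₀ * (Wₛ + Wₜ))
        ((Tₛₛ + (2 : ℝ) • Tₛₜ + Tₜₜ) * W₀ + (Tₛ + Tₜ) * (Wₛ + Wₜ) + ((Tₛ + Tₜ) * (Wₛ + Wₜ) + T₀ * (Wₛₛ + (2 : ℝ) • Wₛₜ + Wₜₜ)))
      = secondVar (T₀ * W₀) (Tₛ * W₀ + T₀ * Wₛ) (Tₛₛ * W₀ + Tₛ * Wₛ + (Tₛ * Wₛ + T₀ * Wₛₛ))
        + secondVar (T₀ * W₀) (Tₜ * W₀ + T₀ * Wₜ) (Tₜₜ * W₀ + Tₜ * Wₜ + (Tₜ * Wₜ + T₀ * Wₜₜ))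
        + 2 * mixedVar (T₀ * W₀) (Tₛ * W₀ + T₀ * Wₛ) (Tₜ * W₀ + T₀ * Wₜ) (Tₛₜ * W₀ + Tₛ * Wₜ + Tₜ * Wₛ + T₀ * Wₛₜ) := by
    have e1 : (Tₛ + Tₜ) * W₀ + T₀ * (Wₛ + Wₜ) = (Tₛ * W₀ + T₀ * Wₛ) + (Tₜ * W₀ + T₀ * Wₜ) := by
      rw [Matrix.add_mul, Matrix.mul_add]; abel
    have e2 : (Tₛₛ + (2 : ℝ) • Tₛₜ + Tₜₜ) * W₀ + (Tₛ + Tₜ) * (Wₛ + Wₜ) + ((Tₛ + Tₜ) * (Wₛ + Wₜ) + T₀ * (Wₛₛ + (2 : ℝ) • Wₛₜ + Wₜₜ))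
        = (Tₛₛ * W₀ + Tₛ * Wₛ + (Tₛ * Wₛ + T₀ * Wₛₛ)) + (2 : ℝ) • (Tₛₜ * W₀ + Tₛ * Wₜ + Tₜ * Wₛ + T₀ * Wₛₜ)
          + (Tₜₜ * W₀ + Tₜ * Wₜ + (Tₜ * Wₜ + T₀ * Wₜₜ)) := by
      simp only [Matrix.add_mul, Matrix.mul_add, smul_add, two_smul]
      abel
    rw [e1, e2]
    exact secondVar_diag _ _ _ _ _ _
  have pA : secondVar A₀ (Aₛ + Aₜ) (Aₛₛ + (2 : ℝ) • Aₛₜ + Aₜₜ) = secondVar A₀ Aₛ Aₛₛ + secondVar A₀ Aₜ Aₜₜ + 2 * mixedVar A₀ Aₛ Aₜ Aₛₜ :=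
    secondVar_diag _ _ _ _ _ _
  rw [pΦ, pF, pA] at hd
  linarith

omit [DecidableEq ν] in
/-- [folklore] **THE GRAM SPLIT IN `hessT` CURRENCY** (the display requested in ruling ρ-g6-5):
`hessT (Φ₀⁻¹; Φ-jets) = 2·hessT ((τ′₀W₀)⁻¹; (τ′W)-jets) + hessT (A₀⁻¹; A-jets)`. -/
theorem hessT_gram_split_jets (T₀ Tₛ Tₜ Tₛₛ Tₜₜ Tₛₜ : Matrix ρ ν ℝ) (A₀ Aₛ Aₜ Aₛₛ Aₜₜ Aₛₜ : Matrix ρ ρ ℝ)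
    (W₀ Wₛ Wₜ Wₛₛ Wₜₜ Wₛₜ : Matrix ν ρ ℝ) (hT : (T₀ * W₀).det ≠ 0) (hA : A₀.det ≠ 0) :
    hessT (gram₀ W₀ (gram₀ T₀ A₀))⁻¹ (gram₁ W₀ Wₛ (gram₀ T₀ A₀) (gram₁ T₀ Tₛ A₀ Aₛ)) (gram₁ W₀ Wₜ (gram₀ T₀ A₀) (gram₁ T₀ Tₜ A₀ Aₜ))
        (gramMix W₀ Wₛ Wₜ Wₛₜ (gram₀ T₀ A₀) (gram₁ T₀ Tₛ A₀ Aₛ) (gram₁ T₀ Tₜ A₀ Aₜ) (gramMix T₀ Tₛ Tₜ Tₛₜ A₀ Aₛ Aₜ Aₛₜ))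
      = 2 * hessT (T₀ * W₀)⁻¹ (Tₛ * W₀ + T₀ * Wₛ) (Tₜ * W₀ + T₀ * Wₜ) (Tₛₜ * W₀ + Tₛ * Wₜ + Tₜ * Wₛ + T₀ * Wₛₜ)
        + hessT A₀⁻¹ Aₛ Aₜ Aₛₜ := by
  have h := mixedVar_gram_split_jets T₀ Tₛ Tₜ Tₛₛ Tₜₜ Tₛₜ A₀ Aₛ Aₜ Aₛₛ Aₜₜ Aₛₜ W₀ Wₛ Wₜ Wₛₛ Wₜₜ Wₛₜ hT hA
  rw [mixedVar_eq_two_mul_hessT (gram₀ W₀ (gram₀ T₀ A₀)), mixedVar_eq_two_mul_hessT (T₀ * W₀), mixedVar_eq_two_mul_hessT A₀] at h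
  linarith

end Main

end Summit.QuantumFields.BalabanUV.Beta.D1BFx.GramWeightJetsMixed

end
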